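import Literature.MathematicalPhysics.QuantumFieldTheory.Balaban1983to89.B9Eq340LadderHolonomy
import Literature.MathematicalPhysics.QuantumFieldTheory.Balaban1983to89.Node00.OpsYTransport
import Literature.MathematicalPhysics.QuantumFieldTheory.Balaban1983to89.B9Eq39Adjoint

/-!
# `Balaban1983to89.B9Eq340ContourLasso` — T. Bałaban, *Propagators for lattice gauge theories in a background field*, Commun. Math. Phys. **99** (1985) 389–434
# [Balaban1985BackgroundPropagators], (3.40) p. 397 with (3.35) p. 396 and (3.3) p. 391: THE LASSO HOLONOMY OF A MULTI-LEG STRAIGHT CONTOUR AND ITS TRANSLATE —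
# `‖U(Γ)·U_κ(end)·U(Γ + e_κ)⁻¹·U_κ(start)⁻¹ − 1‖ ≤ Σ_{bonds b ⊂ Γ} |U(∂p(b, κ)) − 1|` for def-Y's straight-line transporters `parFwdV` on the torus

statement-level skeleton of published theorems with citation tags; proofs where landed; nothing here is a claim about the Yang–Mills mass gap

THE PRINT.  (3.40) p. 397 (transport along «a shortest contour Γ_{x,x′}»), (3.3) p. 391 (`U(Γ) = U(b₁)⋯U(b_n)`), (3.35) p. 396 (small plaquette variables on the cubes).

WHY THIS FILE (dag-n06-i gen 13, N06 bundle F4, row 26, step F-b(ii) of the (P′1) roadmap).  def-Y's bond transporter `parBY i U s z = parTaxiV U s z` runs straight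
legs in the directions `0, 1, …, d−1` (`Node00.OpsYTransport`); inside a double block the contours to `z` and to `z + e_κ` share the legs `< κ`, the leg `κ` is one bond longer, and
the legs `> κ` are translates by `e_κ`.  The covariant difference of a transported test function across the bond `⟨z, z+e_κ⟩` is therefore governed by the LASSO
`U(Γ)U_κ(z)U(Γ+e_κ)⁻¹U_κ(w)⁻¹` of the multi-leg contour `Γ` (legs `> κ`, from `w` to `z`), conjugated by the common prefix.  THIS FILE bounds that lasso by the plaquette
variables along `Γ` (`B9Eq340LadderHolonomy.norm_ladderHol_sub_one_le` leg by leg); the identification with `parTaxiV` under the no-wrapping hypothesis is the sequel.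

WHAT IS PROVED (sorry-free).
* §1 `iterate_shift_shift_comm` (`(z + e_κ) + m e_ν = (z + m e_ν) + e_κ`), ★ `parFwdV_eq_contourProd` (a straight leg is the ordered product of its bond variables),
  `straightLasso_eq_ladderHol`, `rungPlaq_eq_plaqU` (the rungs of a straight leg are r06's plaquette words `plaqU (shiftsV1 P) U ν κ (z + m e_ν)`),
  ★★ `norm_straightLasso_sub_one_le` — `‖parFwdV U ν n z · U_κ(z + n e_ν) · parFwdV U ν n (z + e_κ)⁻¹ · U_κ(z)⁻¹ − 1‖ ≤ Σ_{m<n} ‖U(∂p_{νκ}(z + m e_ν)) − 1‖`.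
* §2 multi-leg contours `legRun U l z` (`l` a list of (direction, length)), `legEnd`, `legDefect κ U l z` (the sum of the plaquette defects swept), ★ `lasso_cons` (one more leg =
  conjugate of the shorter lasso times a straight lasso), ★★★ `norm_lasso_sub_one_le` — `‖legRun U l z · U_κ(legEnd l z) · legRun U l (z+e_κ)⁻¹ · U_κ(z)⁻¹ − 1‖ ≤ legDefect κ U l z`.

HONEST SCOPE.  Elementary; unitary-like bond variables (`T4RelativeLadder.UnitaryLike`, i.e. `‖U(b)‖, ‖U(b)⁻¹‖ ≤ 1` — the `SU(N)`-valued backgrounds); the link to `parTaxiV`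
(forward regime, no wrapping) and the use of (3.35) (n06-j's `B9Eq335PlaquetteAtLettersY`) are NOT here; nothing of [B9] asserted; count-neutral; N06 NOT discharged.
Cell `pub-ymgap` (HUMAN RULING D-0062), Track A node N06 [B9], seat `pub-ymgap-dag-n06-i` (gen 13), 2026-08-27; a NEW file.
-/

namespace Literature.MathematicalPhysics.QuantumFieldTheory.Balaban1983to89.B9Eq340ContourLasso

open Finset
open T4RelativeLadder (UnitaryLike norm_conj_sub_one_eq)
open B9Eq340LadderHolonomy (contourProd contourProd_succ rungPlaq ladderHol norm_ladderHol_sub_one_le)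
open B9BackgroundsKLevelV1 (CfgV1 shiftsV1)
open B9Eq39Adjoint (plaqU)
open Node00 (parFwdV parFwdV_succ)

variable {P : Params} {𝔸 : Type} [NormedRing 𝔸]

/-! ## §1 A straight leg and its translate -/

/-- commuting shifts along an iterate: `(z + e_κ) + m·e_ν = (z + m·e_ν) + e_κ`. [cite: Balaban1985BackgroundPropagators, (3.1) p.390 (the torus), bookkeeping] -/
theorem iterate_shift_shift_comm (ν κ : Fin P.d) (m : ℕ) (z : Site P 0) :
    (fun y : Site P 0 => y.shift ν)^[m] (z.shift κ) = ((fun y : Site P 0 => y.shift ν)^[m] z).shift κ := by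
  induction m generalizing z with
  | zero => rfl
  | succ m ih =>
    rw [Function.iterate_succ_apply, Function.iterate_succ_apply, ← ih]
    congr 1
    exact Site.shift_comm z κ ν

/-- ★ **A STRAIGHT LEG IS THE ORDERED PRODUCT OF ITS BOND VARIABLES**: `parFwdV U ν n z = Π_{m<n} U_ν(z + m e_ν)`. [cite: Balaban1985BackgroundPropagators, (3.3) p.391] -/
theorem parFwdV_eq_contourProd (U : CfgV1 P 𝔸) (ν : Fin P.d) (n : ℕ) (z : Site P 0) :
    parFwdV U ν n z = contourProd (fun m => U ν ((fun y : Site P 0 => y.shift ν)^[m] z)) n := by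
  induction n generalizing z with
  | zero => rfl
  | succ n ih =>
    -- peel the LAST bond on the right-hand side by an auxiliary induction
    have key : ∀ (k : ℕ) (w : Site P 0), contourProd (fun m => U ν ((fun y : Site P 0 => y.shift ν)^[m] w)) (k + 1) =
        U ν w * contourProd (fun m => U ν ((fun y : Site P 0 => y.shift ν)^[m] (w.shift ν))) k := by
      intro k
      induction k with
      | zero => intro w; simp [contourProd]
      | succ k ihk =>
        intro w
        rw [contourProd_succ, ihk w, contourProd_succ, mul_assoc, ← Function.iterate_succ_apply]
    rw [parFwdV_succ, key, ih]

/-- the rungs of a straight leg are r06's plaquette words: `rungPlaq m = U(∂p_{νκ}(z + m e_ν))`. [cite: Balaban1985BackgroundPropagators, (3.1) p.390] -/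
theorem rungPlaq_eq_plaqU (U : CfgV1 P 𝔸) (ν κ : Fin P.d) (z : Site P 0) (m : ℕ) :
    rungPlaq (fun m => U ν ((fun y : Site P 0 => y.shift ν)^[m] z)) (fun m => U ν ((fun y : Site P 0 => y.shift ν)^[m] (z.shift κ)))
        (fun m => U κ ((fun y : Site P 0 => y.shift ν)^[m] z)) m =
      plaqU (shiftsV1 P) U ν κ ((fun y : Site P 0 => y.shift ν)^[m] z) := by
  rw [rungPlaq, plaqU, iterate_shift_shift_comm, Function.iterate_succ_apply']
  rfl

/-- ★★ **THE STRAIGHT LASSO**: for unitary-like bond variables,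
`‖parFwdV U ν n z · U_κ(z + n e_ν) · parFwdV U ν n (z + e_κ)⁻¹ · U_κ(z)⁻¹ − 1‖ ≤ Σ_{m<n} ‖U(∂p_{νκ}(z + m e_ν)) − 1‖`.
[cite: Balaban1985BackgroundPropagators, (3.40) p.397, (3.35) p.396; Balaban1985Averaging, (44)–(47) pp.24–25] -/
theorem norm_straightLasso_sub_one_le [NormOneClass 𝔸] {U : CfgV1 P 𝔸} (hU : ∀ μ x, UnitaryLike (U μ x)) (ν κ : Fin P.d) (n : ℕ) (z : Site P 0) :
    ‖((parFwdV U ν n z * U κ ((fun y : Site P 0 => y.shift ν)^[n] z) * (parFwdV U ν n (z.shift κ))⁻¹ * (U κ z)⁻¹ : 𝔸ˣ) : 𝔸) - 1‖ ≤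
      ∑ m ∈ range n, ‖(plaqU (shiftsV1 P) U ν κ ((fun y : Site P 0 => y.shift ν)^[m] z) : 𝔸) - 1‖ := by
  have h := norm_ladderHol_sub_one_le (R := 𝔸) (h := fun m => U ν ((fun y : Site P 0 => y.shift ν)^[m] z))
    (h' := fun m => U ν ((fun y : Site P 0 => y.shift ν)^[m] (z.shift κ))) (v := fun m => U κ ((fun y : Site P 0 => y.shift ν)^[m] z))
    (fun m => hU _ _) (fun m => hU _ _) (fun m => hU _ _) n
  simp_rw [rungPlaq_eq_plaqU] at h
  rw [ladderHol, ← parFwdV_eq_contourProd, ← parFwdV_eq_contourProd] at h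
  simpa using h

/-! ## §2 Multi-leg contours -/

/-- the transporter along the legs `l = [(ν₁, n₁), (ν₂, n₂), …]` run in order from `z` (each straight and forward). [cite: Balaban1985BackgroundPropagators, (3.3) p.391, (3.40) p.397] -/
def legRun (U : CfgV1 P 𝔸) : List (Fin P.d × ℕ) → Site P 0 → 𝔸ˣ
  | [], _ => 1
  | (ν, n) :: l, z => parFwdV U ν n z * legRun U l ((fun y : Site P 0 => y.shift ν)^[n] z)

/-- the endpoint of the legs. [cite: Balaban1985BackgroundPropagators, (3.40) p.397, bookkeeping] -/
def legEnd : List (Fin P.d × ℕ) → Site P 0 → Site P 0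
  | [], z => z
  | (ν, n) :: l, z => legEnd l ((fun y : Site P 0 => y.shift ν)^[n] z)

/-- the total plaquette defect swept by translating the legs by `e_κ`. [cite: Balaban1985BackgroundPropagators, (3.35) p.396, bookkeeping] -/
def legDefect (κ : Fin P.d) (U : CfgV1 P 𝔸) : List (Fin P.d × ℕ) → Site P 0 → ℝ
  | [], _ => 0
  | (ν, n) :: l, z => (∑ m ∈ range n, ‖(plaqU (shiftsV1 P) U ν κ ((fun y : Site P 0 => y.shift ν)^[m] z) : 𝔸) - 1‖) +
      legDefect κ U l ((fun y : Site P 0 => y.shift ν)^[n] z)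

/-- translating the start translates the end. [cite: Balaban1985BackgroundPropagators, (3.1) p.390, bookkeeping] -/
theorem legEnd_shift (κ : Fin P.d) (l : List (Fin P.d × ℕ)) (z : Site P 0) : legEnd l (z.shift κ) = (legEnd l z).shift κ := by
  induction l generalizing z with
  | nil => rfl
  | cons p l ih =>
    obtain ⟨ν, n⟩ := p
    show legEnd l _ = (legEnd l _).shift κ
    rw [iterate_shift_shift_comm, ih]

/-- the LASSO of the legs `l` from `z` in the rung direction `κ`. [cite: Balaban1985BackgroundPropagators, (3.40) p.397, bookkeeping] -/
def lasso (κ : Fin P.d) (U : CfgV1 P 𝔸) (l : List (Fin P.d × ℕ)) (z : Site P 0) : 𝔸ˣ :=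
  legRun U l z * U κ (legEnd l z) * (legRun U l (z.shift κ))⁻¹ * (U κ z)⁻¹

/-- ★ **ONE MORE LEG**: `lasso ((ν,n) :: l) z = (F · lasso l z₁ · F⁻¹) · (straight lasso of the leg)`, `F = parFwdV U ν n z`, `z₁ = z + n e_ν`.
[cite: Balaban1985BackgroundPropagators, (3.40) p.397, bookkeeping] -/
theorem lasso_cons (κ : Fin P.d) (U : CfgV1 P 𝔸) (ν : Fin P.d) (n : ℕ) (l : List (Fin P.d × ℕ)) (z : Site P 0) :
    lasso κ U ((ν, n) :: l) z =
      (parFwdV U ν n z * lasso κ U l ((fun y : Site P 0 => y.shift ν)^[n] z) * (parFwdV U ν n z)⁻¹) *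
        (parFwdV U ν n z * U κ ((fun y : Site P 0 => y.shift ν)^[n] z) * (parFwdV U ν n (z.shift κ))⁻¹ * (U κ z)⁻¹) := by
  simp only [lasso, legRun, legEnd, iterate_shift_shift_comm, mul_inv_rev]
  group

/-- the legs of unitary-like bond variables are unitary-like. [cite: Balaban1985BackgroundPropagators, (3.40) p.397, bookkeeping] -/
theorem unitaryLike_parFwdV [NormOneClass 𝔸] {U : CfgV1 P 𝔸} (hU : ∀ μ x, UnitaryLike (U μ x)) (ν : Fin P.d) (n : ℕ) (z : Site P 0) :
    UnitaryLike (parFwdV U ν n z) := by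
  induction n generalizing z with
  | zero => exact T4RelativeLadder.UnitaryLike.one
  | succ n ih => rw [parFwdV_succ]; exact (hU ν z).mul (ih _)

/-- the legs and lassos are unitary-like. [cite: Balaban1985BackgroundPropagators, (3.40) p.397, bookkeeping] -/
theorem unitaryLike_legRun [NormOneClass 𝔸] {U : CfgV1 P 𝔸} (hU : ∀ μ x, UnitaryLike (U μ x)) (l : List (Fin P.d × ℕ)) (z : Site P 0) :
    UnitaryLike (legRun U l z) := by
  induction l generalizing z with
  | nil => exact T4RelativeLadder.UnitaryLike.one
  | cons p l ih => obtain ⟨ν, n⟩ := p; exact (unitaryLike_parFwdV hU ν n z).mul (ih _)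

/-- ★★★ **THE MULTI-LEG LASSO IS BOUNDED BY THE PLAQUETTES IT SWEEPS**: for unitary-like bond variables,
`‖legRun U l z · U_κ(legEnd l z) · legRun U l (z + e_κ)⁻¹ · U_κ(z)⁻¹ − 1‖ ≤ legDefect κ U l z`. [cite: Balaban1985BackgroundPropagators, (3.40) p.397, (3.35) p.396; Balaban1985Averaging, (44)–(47) pp.24–25] -/
theorem norm_lasso_sub_one_le [NormOneClass 𝔸] {U : CfgV1 P 𝔸} (hU : ∀ μ x, UnitaryLike (U μ x)) (κ : Fin P.d) (l : List (Fin P.d × ℕ)) (z : Site P 0) :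
    ‖(lasso κ U l z : 𝔸) - 1‖ ≤ legDefect κ U l z := by
  induction l generalizing z with
  | nil => simp [lasso, legRun, legEnd, legDefect]
  | cons p l ih =>
    obtain ⟨ν, n⟩ := p
    rw [lasso_cons]
    have hF := unitaryLike_parFwdV hU ν n z
    set z₁ := (fun y : Site P 0 => y.shift ν)^[n] z with hz₁
    have hA : ‖((parFwdV U ν n z * lasso κ U l z₁ * (parFwdV U ν n z)⁻¹ : 𝔸ˣ) : 𝔸)‖ ≤ 1 :=
      ((hF.mul ((((unitaryLike_legRun hU l z₁).mul (hU κ _)).mul (unitaryLike_legRun hU l _).inv).mul (hU κ z₁).inv)).mul hF.inv).1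
    have hconj : ‖((parFwdV U ν n z * lasso κ U l z₁ * (parFwdV U ν n z)⁻¹ : 𝔸ˣ) : 𝔸) - 1‖ = ‖(lasso κ U l z₁ : 𝔸) - 1‖ := by
      rw [Units.val_mul, Units.val_mul]; exact norm_conj_sub_one_eq hF _
    calc _ ≤ ‖((parFwdV U ν n z * lasso κ U l z₁ * (parFwdV U ν n z)⁻¹ : 𝔸ˣ) : 𝔸) - 1‖ +
          ‖((parFwdV U ν n z * U κ z₁ * (parFwdV U ν n (z.shift κ))⁻¹ * (U κ z)⁻¹ : 𝔸ˣ) : 𝔸) - 1‖ :=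
          B9Eq340LadderHolonomy.norm_mul_sub_one_le hA
      _ ≤ legDefect κ U l z₁ + ∑ m ∈ range n, ‖(plaqU (shiftsV1 P) U ν κ ((fun y : Site P 0 => y.shift ν)^[m] z) : 𝔸) - 1‖ := by
          rw [hconj]; exact add_le_add (ih z₁) (norm_straightLasso_sub_one_le hU ν κ n z)
      _ = legDefect κ U ((ν, n) :: l) z := by rw [legDefect, hz₁, add_comm]

/-- uniform form: if every plaquette `p_{νκ}` met has `‖U(∂p) − 1‖ ≤ δ`, the lasso is within (total length)·δ of `1`. [cite: Balaban1985BackgroundPropagators, (3.40) p.397, (3.35) p.396] -/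
theorem legDefect_le_of_uniform (κ : Fin P.d) (U : CfgV1 P 𝔸) {δ : ℝ} (hδ : ∀ ν z, ‖(plaqU (shiftsV1 P) U ν κ z : 𝔸) - 1‖ ≤ δ)
    (l : List (Fin P.d × ℕ)) (z : Site P 0) : legDefect κ U l z ≤ ((l.map Prod.snd).sum : ℕ) * δ := by
  induction l generalizing z with
  | nil => simp [legDefect]
  | cons p l ih =>
    obtain ⟨ν, n⟩ := p
    rw [legDefect, List.map_cons, List.sum_cons, Nat.cast_add, add_mul]
    refine add_le_add ?_ (ih _)
    calc ∑ m ∈ range n, ‖(plaqU (shiftsV1 P) U ν κ ((fun y : Site P 0 => y.shift ν)^[m] z) : 𝔸) - 1‖ ≤ ∑ m ∈ range n, δ :=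
          sum_le_sum fun m _ => hδ ν _
      _ = n * δ := by rw [sum_const, card_range, nsmul_eq_mul]

end Literature.MathematicalPhysics.QuantumFieldTheory.Balaban1983to89.B9Eq340ContourLasso
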